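import Literature.AnabelianGeometry.EtaleTheta.Discharge.Sec2InducesMuConjCalculus
import Literature.AnabelianGeometry.EtaleTheta.RigidOfSetting
import HarnessLib

/-!
# [EtTh] Prop 2.14 (iii) over the interface: the cusp-label clauses live in the INPUT `cuspY`
# (proof-only companion; FACT-LIST rows F-0633 `Prop214_iii_bi`, F-0634 `Prop214_iii_mono`)

Mochizuki, *The Étale Theta Function …* [EtTh], Publ. RIMS 45 (2009), §2, Prop. 2.14 (iii), PRIMS
text pp.49–50 (locators `p.N` = PDF pages; bib key `MochizukiEtTh2009`): "every automorphism of `M`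
induces an automorphism of `Π^tp_Y`, hence of the set of cusps of `Y` … the resulting homomorphism
`Aut(M) → (l·ℤ) ⋊ {±1}` is surjective [resp. has image between `(N·l·ℤ) ⋊ {±1}` and `(N†·l·ℤ) ⋊ {±1}`]".

PROOF-ONLY companion of `ThetaRigidity.lean` (seat abc-iut-L2-t2), written by the cell `abc-iut` (seat
abc-iut-f-149, F-TRANCHES 149 of D-0078 (S1)) for the FROZEN FACT-LIST rows F-0633
`RigidData.Prop214_iii_bi` and F-0634 `RigidData.Prop214_iii_mono`, whose universal closures over the
lawless interface `RigidData N l` are REFUTED (`RigidData.Toy.not_forall_prop214_iii_bi/_mono`, seat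
abc-iut-w5-d175). This file locates their content EXACTLY, for every `R : RigidData N l`:

* §1 `RigidData.actsOnCuspsBy_of_cuspY_empty`, `RigidData.prop214_iii_mono_iff_of_cuspY_empty`,
  `RigidData.prop214_iii_bi_iff_of_cuspY_empty` — **with EMPTY cusp labels both rows COLLAPSE to "every
  automorphism of the model environment induces an automorphism of `Π^tp_Y`"** (Prop. 2.11 (ii)-type
  content), hence HOLD given Cor. 2.18 (iii) (`Cor218_iii_quotient`, F-0623; abc-iut-f-148's
  `exists_induces_iso`): `prop214_iii_mono_of_cuspY_empty`, `prop214_iii_bi_of_cuspY_empty`;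
* §2 `RigidData.not_actsOnCuspsBy_zero_negOne`, `RigidData.not_prop214_iii_mono_of_cuspY`,
  `RigidData.not_prop214_iii_bi_of_cuspY` — **with the degenerate labelling `1 ↦ {⊥}`, `−1 ↦ ∅` both rows
  FAIL** (the surjectivity clause at `(s, ε) = (0, −1)` asks for an automorphism carrying the cusps
  labelled `1` onto those labelled `−1`);
* §3 `RigidData.exists_relabel_not_prop214_iii` — hence EVERY `R` has a relabelling (only the field
  `cuspY` changed) at which both rows fail;
* §4 at the lane-C2 model of abc-iut-L2-t8 (`DoubleUnderline.rigidData μ hC hS h15 L`, whose cusp labels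
  are the lawless INPUT `L : CuspLabels`, `RigidOfSetting.lean`):
  `DoubleUnderline.not_forall_cuspLabels_rigidData_prop214_iii_mono/_bi` — **for every §1 datum the rows
  fail at some labelling**, and `DoubleUnderline.rigidData_prop214_iii_mono/_bi_of_cuspLabels_empty` —
  they hold at the empty labelling given Cor. 2.18 (iii) of the model.

READING (numbers, not adjectives): as typed, the cusp-label content of Prop. 2.14 (iii) is carried
entirely by the unconstrained field `cuspY`; a consumable instance form needs the GENUINE labelled cusps
of `Y` (p.42: read off the dual graph of the special fibre; TODO-merge(abc-iut-L2-t1/abc-iut-L3-t2) in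
`RigidOfSetting.lean`). Nothing of [EtTh] (refereed) is asserted or denied; no side taken on [IUTchIII]
Cor. 3.12; typed ≠ proved. No definitions, no instances.
-/

namespace Literature.AnabelianGeometry.EtaleTheta

universe u

namespace RigidData

variable {N : ℕ+} {l : ℕ} (R : RigidData.{u} N l)

/-! ## §1. Empty labels: the rows collapse to inducedness -/

/-- With empty cusp labels every automorphism of `Π^tp_Y` "acts on the cusps" by every `(s, ε)`.
[cite: MochizukiEtTh2009, Prop 2.14(iii) p.50] -/
theorem actsOnCuspsBy_of_cuspY_empty (h : ∀ n, R.cuspY n = ∅) (a : R.PiY ≃ₜ* R.PiY) (s : ℤ) (ε : ℤˣ) :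
    R.ActsOnCuspsBy a s ε := fun n => by
  rw [h n, h, Set.image_empty]

/-- The identity automorphism of the model mono-theta environment induces the identity of `Π^tp_Y`.
[cite: MochizukiEtTh2009, Prop 2.14(iii) p.49] -/
theorem induces_refl_mono {η : R.PiYdd → R.mu} (hη : η ∈ R.thetaCocycles) :
    R.Induces (MonoThetaEnv.Iso.refl (R.modelMono hη)).e.toMulEquiv (ContinuousMulEquiv.refl R.PiY) :=
  fun _ => rfl

/-- The identity automorphism of the model bi-theta environment (an explicit inhabitant of its `Iso`
type) induces the identity of `Π^tp_Y`. [cite: MochizukiEtTh2009, Def 2.13(iii) p.48] -/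
theorem exists_biIso_induces_refl {η : R.PiYdd → R.mu} (hη : η ∈ R.thetaCocycles) :
    ∃ α : (R.modelBi hη).Iso (R.modelBi hη), R.Induces α.e.toMulEquiv (ContinuousMulEquiv.refl R.PiY) := by
  have hid : (fun H : Subgroup R.env =>
      H.map (ContinuousMulEquiv.refl R.env).toMulEquiv.toMonoidHom) = id := by
    funext H; exact Subgroup.map_id H
  refine ⟨{ e := ContinuousMulEquiv.refl R.env
            map_D := (MonoThetaEnv.Iso.refl (R.modelMono hη)).map_D
            map_sTheta := by
              change (fun H : Subgroup R.env =>
                H.map (ContinuousMulEquiv.refl R.env).toMulEquiv.toMonoidHom) '' _ = _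
              rw [hid, Set.image_id]
            map_sAlg := by
              change (fun H : Subgroup R.env =>
                H.map (ContinuousMulEquiv.refl R.env).toMulEquiv.toMonoidHom) '' _ = _
              rw [hid, Set.image_id] }, fun _ => rfl⟩

/-- **F-0634 at EMPTY labels ⟺ inducedness**: if `cuspY ≡ ∅`, `Prop214_iii_mono` holds iff every
automorphism of every model mono-theta environment `M(η)` induces an automorphism of `Π^tp_Y`.
[cite: MochizukiEtTh2009, Prop 2.14(iii) p.49] -/
theorem prop214_iii_mono_iff_of_cuspY_empty (h : ∀ n, R.cuspY n = ∅) :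
    R.Prop214_iii_mono ↔ ∀ (η : R.PiYdd → R.mu) (hη : η ∈ R.thetaCocycles)
      (α : (R.modelMono hη).Iso (R.modelMono hη)), ∃ a, R.Induces α.e.toMulEquiv a := by
  constructor
  · intro hP η hη α
    obtain ⟨a, ha, -⟩ := (hP η hη).1 α
    exact ⟨a, ha⟩
  · intro hI η hη
    refine ⟨fun α => ?_, fun s ε _ => ?_⟩
    · obtain ⟨a, ha⟩ := hI η hη α
      exact ⟨a, ha, 0, 1, dvd_zero _, R.actsOnCuspsBy_of_cuspY_empty h a 0 1⟩
    · exact ⟨MonoThetaEnv.Iso.refl _, ContinuousMulEquiv.refl R.PiY, R.induces_refl_mono hη,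
        R.actsOnCuspsBy_of_cuspY_empty h _ s ε⟩

/-- **F-0633 at EMPTY labels ⟺ inducedness**: if `cuspY ≡ ∅`, `Prop214_iii_bi` holds iff every
automorphism of every model bi-theta environment `B(η)` induces an automorphism of `Π^tp_Y`.
[cite: MochizukiEtTh2009, Prop 2.14(iii) p.50] -/
theorem prop214_iii_bi_iff_of_cuspY_empty (h : ∀ n, R.cuspY n = ∅) :
    R.Prop214_iii_bi ↔ ∀ (η : R.PiYdd → R.mu) (hη : η ∈ R.thetaCocycles)
      (α : (R.modelBi hη).Iso (R.modelBi hη)), ∃ a, R.Induces α.e.toMulEquiv a := by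
  constructor
  · intro hP η hη α
    obtain ⟨a, ha, -⟩ := (hP η hη).1 α
    exact ⟨a, ha⟩
  · intro hI η hη
    refine ⟨fun α => ?_, fun s ε _ => ?_⟩
    · obtain ⟨a, ha⟩ := hI η hη α
      exact ⟨a, ha, 0, 1, dvd_zero _, R.actsOnCuspsBy_of_cuspY_empty h a 0 1⟩
    · obtain ⟨α, hα⟩ := R.exists_biIso_induces_refl hη
      exact ⟨α, ContinuousMulEquiv.refl R.PiY, hα, R.actsOnCuspsBy_of_cuspY_empty h _ s ε⟩

/-- **F-0634 HOLDS at empty labels given Cor. 2.18 (iii)** (`Cor218_iii_quotient`, F-0623: then every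
automorphism of `Π^tp_Y[μ_N]` induces one of `Π^tp_Y`, abc-iut-f-148's `exists_induces_iso`).
[cite: MochizukiEtTh2009, Prop 2.14(iii) p.49] -/
theorem prop214_iii_mono_of_cuspY_empty (h : ∀ n, R.cuspY n = ∅) (h218 : R.Cor218_iii_quotient) :
    R.Prop214_iii_mono :=
  (R.prop214_iii_mono_iff_of_cuspY_empty h).2 fun _ _ α => exists_induces_iso h218 α

/-- **F-0633 HOLDS at empty labels given Cor. 2.18 (iii)** (`Cor218_iii_quotient`, F-0623).
[cite: MochizukiEtTh2009, Prop 2.14(iii) p.50] -/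
theorem prop214_iii_bi_of_cuspY_empty (h : ∀ n, R.cuspY n = ∅) (h218 : R.Cor218_iii_quotient) :
    R.Prop214_iii_bi :=
  (R.prop214_iii_bi_iff_of_cuspY_empty h).2 fun _ _ α =>
    exists_induces_of_cor218_iii_quotient h218 α.e.toMulEquiv ⟨α.e.continuous, α.e.symm.continuous⟩

/-! ## §2. The degenerate labelling `1 ↦ {⊥}`, `−1 ↦ ∅`: the rows fail -/

/-- If the label `1` carries exactly the trivial subgroup and the label `−1` carries nothing, then NO
automorphism of `Π^tp_Y` acts on the cusps by `(s, ε) = (0, −1)`.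
[cite: MochizukiEtTh2009, Prop 2.14(iii) p.50] -/
theorem not_actsOnCuspsBy_zero_negOne (h1 : R.cuspY 1 = {⊥}) (hneg : R.cuspY (-1) = ∅)
    (a : R.PiY ≃ₜ* R.PiY) : ¬ R.ActsOnCuspsBy a 0 (-1) := by
  intro h
  have h' := h 1
  rw [h1, Set.image_singleton, Units.val_neg, Units.val_one, mul_one, add_zero, hneg] at h'
  exact (Set.singleton_nonempty _).ne_empty h'

/-- **F-0634 FAILS at the degenerate labelling**: the surjectivity clause of `Prop214_iii_mono` at
`(s, ε) = (0, −1)` (`l ∣ 0`) has no witness. [cite: MochizukiEtTh2009, Prop 2.14(iii) p.49] -/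
theorem not_prop214_iii_mono_of_cuspY (h1 : R.cuspY 1 = {⊥}) (hneg : R.cuspY (-1) = ∅) :
    ¬ R.Prop214_iii_mono := by
  intro h
  obtain ⟨η, hη⟩ := R.thetaCocycles_nonempty
  obtain ⟨-, a, -, hact⟩ := (h η hη).2 0 (-1) (dvd_zero _)
  exact R.not_actsOnCuspsBy_zero_negOne h1 hneg a hact

/-- **F-0633 FAILS at the degenerate labelling**: the surjectivity clause of `Prop214_iii_bi` at
`(s, ε) = (0, −1)` (`N·l ∣ 0`) has no witness. [cite: MochizukiEtTh2009, Prop 2.14(iii) p.50] -/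
theorem not_prop214_iii_bi_of_cuspY (h1 : R.cuspY 1 = {⊥}) (hneg : R.cuspY (-1) = ∅) :
    ¬ R.Prop214_iii_bi := by
  intro h
  obtain ⟨η, hη⟩ := R.thetaCocycles_nonempty
  obtain ⟨-, a, -, hact⟩ := (h η hη).2 0 (-1) (dvd_zero _)
  exact R.not_actsOnCuspsBy_zero_negOne h1 hneg a hact

/-! ## §3. Every `RigidData` has a relabelling at which the rows fail -/

/-- **Relabelling**: for every `R : RigidData N l`, replacing ONLY the field `cuspY` by the labelling
`1 ↦ {⊥}`, `n ↦ ∅` (`n ≠ 1`) — same environment data, theta subquotients, cyclotomic identification and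
`X`-cusps — makes `Prop214_iii_mono` and `Prop214_iii_bi` both FAIL: the rows constrain the labelling
input, not the group data. [cite: MochizukiEtTh2009, Prop 2.14(iii) p.50] -/
theorem exists_relabel_not_prop214_iii :
    ∃ cY : ℤ → Set (Subgroup R.PiY),
      ¬ ({ R with cuspY := cY } : RigidData.{u} N l).Prop214_iii_mono ∧
      ¬ ({ R with cuspY := cY } : RigidData.{u} N l).Prop214_iii_bi :=
  ⟨fun n => if n = 1 then {⊥} else ∅,
    not_prop214_iii_mono_of_cuspY _ (by simp) (by simp),
    not_prop214_iii_bi_of_cuspY _ (by simp) (by simp)⟩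

end RigidData

/-! ## §4. At the lane-C2 model: the rows are a schema in the input `CuspLabels` -/

namespace ThetaSetting.EtaleThetaData.DoubleUnderline

open Literature.AnabelianGeometry.SemiGraphs

variable {p : ℕ} [Fact p.Prime] {D : ThetaSetting p} {E : D.EtaleThetaData} {l : ℕ}
  (C : E.DoubleUnderline l) {N : ℕ+} (μ : D.CyclotomeMod l N)

/-- **F-0634 at the §1 model is a schema in the cusp-label input**: for EVERY §1 datum there is a
labelling `L` (`1 ↦ {⊥}`, else `∅`; no `X`-cusps) at which `(C.rigidData μ hC hS h15 L).Prop214_iii_mono`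
FAILS. [cite: MochizukiEtTh2009, Prop 2.14(iii) p.49] -/
theorem not_forall_cuspLabels_rigidData_prop214_iii_mono (hC : D.Compat) (hS : D.Sec2Hyps)
    (h15 : Prop15iii E hC) :
    ¬ ∀ L : C.CuspLabels, (C.rigidData μ hC hS h15 L).Prop214_iii_mono := fun h =>
  (C.rigidData μ hC hS h15 ⟨fun n => if n = 1 then {⊥} else ∅, fun _ => ∅, fun _ => rfl⟩)
    |>.not_prop214_iii_mono_of_cuspY (by simp) (by simp) (h _)

/-- **F-0633 at the §1 model is a schema in the cusp-label input** (same labelling).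
[cite: MochizukiEtTh2009, Prop 2.14(iii) p.50] -/
theorem not_forall_cuspLabels_rigidData_prop214_iii_bi (hC : D.Compat) (hS : D.Sec2Hyps)
    (h15 : Prop15iii E hC) :
    ¬ ∀ L : C.CuspLabels, (C.rigidData μ hC hS h15 L).Prop214_iii_bi := fun h =>
  (C.rigidData μ hC hS h15 ⟨fun n => if n = 1 then {⊥} else ∅, fun _ => ∅, fun _ => rfl⟩)
    |>.not_prop214_iii_bi_of_cuspY (by simp) (by simp) (h _)

/-- **F-0634 at the §1 model HOLDS at the EMPTY labelling, given Cor. 2.18 (iii) of the model** (F-0623,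
`Cor218_iii_quotient`; by abc-iut-f-147's `rigidData_cor218_iii_quotient_iff` this is temp-slimness of
`Π^tp_{Y̲̲}`). [cite: MochizukiEtTh2009, Prop 2.14(iii) p.49] -/
theorem rigidData_prop214_iii_mono_of_cuspLabels_empty (hC : D.Compat) (hS : D.Sec2Hyps)
    (h15 : Prop15iii E hC) (cX : ZMod l → Set (Subgroup C.Huu)) (hcX : ∀ a, cX (-a) = cX a)
    (h218 : (C.rigidData μ hC hS h15 ⟨fun _ => ∅, cX, hcX⟩).Cor218_iii_quotient) :
    (C.rigidData μ hC hS h15 ⟨fun _ => ∅, cX, hcX⟩).Prop214_iii_mono :=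
  RigidData.prop214_iii_mono_of_cuspY_empty _ (fun _ => rfl) h218

/-- **F-0633 at the §1 model HOLDS at the EMPTY labelling, given Cor. 2.18 (iii) of the model.**
[cite: MochizukiEtTh2009, Prop 2.14(iii) p.50] -/
theorem rigidData_prop214_iii_bi_of_cuspLabels_empty (hC : D.Compat) (hS : D.Sec2Hyps)
    (h15 : Prop15iii E hC) (cX : ZMod l → Set (Subgroup C.Huu)) (hcX : ∀ a, cX (-a) = cX a)
    (h218 : (C.rigidData μ hC hS h15 ⟨fun _ => ∅, cX, hcX⟩).Cor218_iii_quotient) :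
    (C.rigidData μ hC hS h15 ⟨fun _ => ∅, cX, hcX⟩).Prop214_iii_bi :=
  RigidData.prop214_iii_bi_of_cuspY_empty _ (fun _ => rfl) h218

end ThetaSetting.EtaleThetaData.DoubleUnderline

end Literature.AnabelianGeometry.EtaleTheta
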